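import Literature.AlgebraicGeometry.Resolution.NodalBlowupChartAlgebra
import Mathlib.RingTheory.Polynomial.ScaleRoots
import HarnessLib

/-!
# The strict transforms of the `V(𝔭_{ab})` on the chart `t_a ≠ 0` of the blow-up of `k⟦u, v, t⟧` in `(u, v, t_a, t_{a'})` are irreducible

Topic: `Literature/AlgebraicGeometry/Resolution`. Commutative algebra for the last sentence of the
chart computation in the proof of de Jong 1996, Claim 4.27 (p. 76), on the chart "`t₁ ≠ 0`" of the
blow-up of `Spec k⟦u, v, t₁, …, t_{d-1}⟧/(uv - t₁ ⋯ t_s)` in `(u, v, t₁, t₂)`: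

> "Chart "`t₁ ≠ 0`". Here we have coordinates `u, v, t₁, …, t_{d-1}, u', v', t₂'` and equations
> `u = t₁u'`, `v = t₁v'`, `t₂ = t₁t₂'` and `u'v' - t₂' t₃ ⋯ t_s = 0`. (…) The irreducible
> component `u' = v' = t₂' = t₃ = 0` of the singular locus maps onto `u = v = t₂ = t₃ = 0`, the
> component `u' = v' = t₃ = t₄ = 0` is the strict transform of the component `u = v = t₃ = t₄ = 0`."

Here, as in `NodalBlowupChartAlgebra.lean`, the centre is `𝔓 = (u, v, t_a, t_{a'})` for any
ordered pair `a ≠ a'`, the chart ring is the affine blowup algebra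
`T = P[𝔓/t_a] ⊆ P[1/t_a]`, `P = k⟦u, v, t₁, …, t_m⟧` (`DeJong1996.ChartRing`), with generators
`u' = u/t_a`, `v' = v/t_a`, `t_{a'}' = t_{a'}/t_a` (`DeJong1996.cgen`). PROVED:

* `blowupAlgebra.testHom` — **test maps**: a ring map `ψ : R → E` with `ψ(b)` a unit induces
  `R[I/b] ⊆ R[1/b] → E`; its values on `R` and on the generators `x/b`.
* `DeJong1996.adjoin_cgen_eq_top` — `T` is generated over `P` by `u', v', t_{a'}'`.
* `DeJong1996.idealA k m s a a' c = (u', v', t_{a'}', t_c)` ("`u' = v' = t₂' = t₃ = 0`") and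
  `DeJong1996.idealB k m s a a' c c' = (u', v', t_c, t_{c'})` ("`u' = v' = t₃ = t₄ = 0`"), for
  `c, c'` among the remaining indices `< s`: both are **prime ideals of `T` not containing `t_a`**
  (`isPrime_idealA`, `algebraMap_X_notMem_idealA`, `isPrime_idealB`, `algebraMap_X_notMem_idealB`),
  both contain the strict transform `F_t = u'v' - t_{a'}' ∏''` of the relation, and they contain
  `𝔓_{a'c} T` resp. `𝔓_{cc'} T`. Proof: `T/(u', v', t_{a'}', t_c)` is a quotient of
  `P/𝔓_{a'c}` (the generators die), and the test map `T → Frac(P/𝔓_{a'c})` (which kills the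
  ideal, `t_a ∉ 𝔓_{a'c}`) splits it, so `T/(u', v', t_{a'}', t_c) ≅ P/𝔓_{a'c}`, a domain in which
  `t_a ≠ 0`; likewise `T/(u', v', t_c, t_{c'})` is a quotient of `(P/𝔓_{cc'})[Y]`, `Y ↦ t_{a'}'`,
  by an ideal containing `t_a Y - t_{a'}` and contained in the kernel of `Y ↦ t_{a'}/t_a` into
  `Frac(P/𝔓_{cc'})`, which is `(t_a Y - t_{a'})` because `t_{a'}` is a non-zero-divisor modulo
  `t_a` in `P/𝔓_{cc'}` (`Polynomial.mem_span_C_mul_X_sub_C_of_eval₂_div_eq_zero`, via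
  `Polynomial.scaleRoots`).
* `DeJong1996.exists_prime_le_of_forall_derivation_apply_mem` — combined with the Jacobian
  conclusion `mem_of_forall_derivation_apply_mem_T`: a prime `Q` of `T` into which every
  derivation takes `F_t` contains one of these primes `𝔯 ∌ t_a`, `𝔯 ∋ F_t`, `𝔯 ⊇ 𝔓_{pq} T` for a
  pair `p ≠ q` below `s` different from `a` — the singular point lies on the strict transform of
  `V(𝔭_{pq})`.

## Sources

* A. J. de Jong, *Smoothness, semi-stability and alterations*, Publ. Math. IHÉS 83 (1996), 4.27,
  p. 76. [DeJong1996]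
-/

noncomputable section

open IsLocalization Polynomial

namespace Literature.AlgebraicGeometry.Resolution

universe u v

/-! ## Test maps out of an affine blowup algebra -/

section TestHom

variable {R : Type u} [CommRing R] (I : Ideal R) (b : R) {E : Type v} [CommRing E]
  (ψ : R →+* E) (hb : IsUnit (ψ b))

/-- **Test map**: a ring map `ψ : R → E` under which `b` becomes a unit extends to `R[1/b]` and
restricts to the affine blowup algebra `R[I/b] ⊆ R[1/b]`. [folklore] -/
def blowupAlgebra.testHom : blowupAlgebra I b →+* E :=
  (Localization.awayLift ψ b hb).comp (blowupAlgebra I b).val.toRingHom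

/-- The test map on the image of `R`. [folklore] -/
@[simp]
theorem blowupAlgebra.testHom_algebraMap (r : R) :
    blowupAlgebra.testHom I b ψ hb (algebraMap R (blowupAlgebra I b) r) = ψ r := by
  change Localization.awayLift ψ b hb ((algebraMap R (blowupAlgebra I b) r : Localization.Away b)) = ψ r
  rw [Subalgebra.coe_algebraMap]
  exact IsLocalization.Away.lift_eq b hb r

/-- The test map on a generator `x/b`: `testHom (x/b) · ψ(b) = ψ(x)`. [folklore] -/
theorem blowupAlgebra.testHom_gen_mul (x : R) (hx : x ∈ I) :
    blowupAlgebra.testHom I b ψ hb (blowupAlgebra.gen I b x hx) * ψ b = ψ x := by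
  rw [← blowupAlgebra.testHom_algebraMap I b ψ hb b, ← map_mul, blowupAlgebra.gen_mul_algebraMap,
    blowupAlgebra.testHom_algebraMap]

/-- The test map kills `x/b` when `ψ(x) = 0`. [folklore] -/
theorem blowupAlgebra.testHom_gen_eq_zero {x : R} (hx : x ∈ I) (h : ψ x = 0) :
    blowupAlgebra.testHom I b ψ hb (blowupAlgebra.gen I b x hx) = 0 := by
  have := blowupAlgebra.testHom_gen_mul I b ψ hb x hx
  rw [h] at this
  exact (hb.mul_left_eq_zero).mp this

end TestHom

/-! ## A one-variable kernel: `Y ↦ β/α` -/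

section Kernel

variable {D : Type u} [CommRing D] [IsDomain D] {K : Type v} [Field K] [Algebra D K]
  [IsFractionRing D K]

/-- If `α q = (α Y - β) g` in `D[Y]` and `α ∣ β x ⇒ α ∣ x`, then `α ∣ g` coefficientwise, so
`q ∈ (α Y - β)`. [folklore] -/
theorem Polynomial.mem_span_of_C_mul_eq {α β : D} (hα : α ≠ 0) (hαβ : ∀ x : D, α ∣ β * x → α ∣ x)
    {q g : D[X]} (h : C α * q = (C α * X - C β) * g) : q ∈ Ideal.span {C α * X - C β} := by
  -- every coefficient of `g` is divisible by `α`
  have hg : C α ∣ g := by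
    rw [Polynomial.C_dvd_iff_dvd_coeff]
    intro i
    apply hαβ
    -- compare coefficients of `Y^i` in `α q = (α Y - β) g`:
    -- `α q_i = α g_{i-1} - β g_i` (with `g_{-1} = 0`)
    have hi := congrArg (fun p : D[X] => p.coeff i) h
    simp only [coeff_C_mul, sub_mul, coeff_sub] at hi
    rcases i with _ | i
    · simp only [mul_coeff_zero, coeff_X_zero, coeff_C_zero, mul_zero, zero_mul, zero_sub] at hi
      refine ⟨-q.coeff 0, ?_⟩
      linear_combination hi
    · rw [show (C α * X : D[X]) = X * C α by ring, mul_assoc, coeff_X_mul, coeff_C_mul] at hi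
      refine ⟨g.coeff i - q.coeff (i + 1), ?_⟩
      linear_combination hi
  obtain ⟨g', rfl⟩ := hg
  have hC : (C α : D[X]) ≠ 0 := by simpa using hα
  have : q = (C α * X - C β) * g' := by
    apply mul_left_cancel₀ hC
    rw [h]
    ring
  rw [this]
  exact Ideal.mul_mem_right _ _ (Ideal.subset_span rfl)

/-- **The kernel of `D[Y] → Frac D`, `Y ↦ β/α`, is `(α Y - β)`** when `D` is a domain, `α ≠ 0`
and `α ∣ β x ⇒ α ∣ x` (e.g. `α` prime not dividing `β`): clearing denominators
(`Polynomial.scaleRoots`) gives `αⁿ p ∈ (α Y - β)`, and the hypothesis peels off the `α`'s.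
[folklore] -/
theorem Polynomial.mem_span_C_mul_X_sub_C_of_aeval_div_eq_zero {α β : D} (hα : α ≠ 0)
    (hαβ : ∀ x : D, α ∣ β * x → α ∣ x) {p : D[X]}
    (hp : aeval (algebraMap D K β / algebraMap D K α) p = 0) :
    p ∈ Ideal.span {C α * X - C β} := by
  have hinj : Function.Injective (algebraMap D K) := IsFractionRing.injective D K
  -- `H = scaleRoots p α` has the root `β`
  have hH : aeval (algebraMap D K β) (scaleRoots p α) = 0 :=
    scaleRoots_aeval_eq_zero_of_aeval_div_eq_zero hinj hp (mem_nonZeroDivisors_of_ne_zero hα)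
  have hroot : (scaleRoots p α).eval β = 0 := by
    apply hinj
    rw [map_zero, ← Polynomial.eval₂_hom, ← Polynomial.aeval_def, hH]
  obtain ⟨G, hG⟩ := Polynomial.dvd_iff_isRoot.mpr hroot
  -- substitute `Y ↦ α Y`: `αⁿ p = (α Y - β) · G(α Y)`
  have hsub : C α ^ p.natDegree * p = (C α * X - C β) * eval₂ C (C α * X) G := by
    have h1 : eval₂ C (C α * X) (scaleRoots p α) = C α ^ p.natDegree * eval₂ C X p :=
      scaleRoots_eval₂_mul C X α
    rw [eval₂_C_X] at h1
    rw [← h1, hG, eval₂_mul, eval₂_sub, eval₂_X, eval₂_C]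
  -- peel off the powers of `α`
  suffices key : ∀ (n : ℕ) (q : D[X]), (∃ g, C α ^ n * q = (C α * X - C β) * g) →
      q ∈ Ideal.span {C α * X - C β} from key p.natDegree p ⟨_, hsub⟩
  intro n
  induction n with
  | zero =>
    rintro q ⟨g, hg⟩
    rw [pow_zero, one_mul] at hg
    rw [hg]
    exact Ideal.mul_mem_right _ _ (Ideal.subset_span rfl)
  | succ n ih =>
    rintro q ⟨g, hg⟩
    apply ih
    -- `α · (αⁿ q) = (α Y - β) g`, so `αⁿ q ∈ (α Y - β)`
    have hmem : C α ^ n * q ∈ Ideal.span {C α * X - C β} :=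
      Polynomial.mem_span_of_C_mul_eq hα hαβ (q := C α ^ n * q) (g := g) (by rw [← hg]; ring)
    obtain ⟨g', hg'⟩ := Ideal.mem_span_singleton'.mp hmem
    exact ⟨g', by rw [← hg', mul_comm]⟩

end Kernel

namespace DeJong1996

variable (k : Type u) [Field k] (m s : ℕ) (a a' : Fin m)

local notation3 "𝙿" => MvPowerSeries (Fin 2 ⊕ Fin m) k
local notation3 "𝚃" => ChartRing k m a a' (MvPowerSeries.X (Sum.inr a) : MvPowerSeries (Fin 2 ⊕ Fin m) k)

/-! ## Generation of the chart ring by `u', v', t_{a'}'` -/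

/-- Membership of the four centre variables in `centreVars` (term-mode forms). [folklore] -/
theorem inl_zero_mem_centreVars : (Sum.inl 0 : Fin 2 ⊕ Fin m) ∈ centreVars m a a' := by
  simp [centreVars]

/-- See `inl_zero_mem_centreVars`. [folklore] -/
theorem inl_one_mem_centreVars : (Sum.inl 1 : Fin 2 ⊕ Fin m) ∈ centreVars m a a' := by
  simp [centreVars]

/-- See `inl_zero_mem_centreVars`. [folklore] -/
theorem inr_left_mem_centreVars : (Sum.inr a : Fin 2 ⊕ Fin m) ∈ centreVars m a a' := by
  simp [centreVars]

/-- See `inl_zero_mem_centreVars`. [folklore] -/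
theorem inr_right_mem_centreVars : (Sum.inr a' : Fin 2 ⊕ Fin m) ∈ centreVars m a a' := by
  simp [centreVars]

/-- The three non-trivial generators `u' = u/t_a`, `v' = v/t_a`, `t_{a'}' = t_{a'}/t_a` of the
chart ring `P[𝔓/t_a]`, as a set. [cite: DeJong1996, 4.27, p. 76] -/
def chartGens : Set 𝚃 :=
  {cgen _ (Sum.inl 0) (inl_zero_mem_centreVars m a a'),
    cgen _ (Sum.inl 1) (inl_one_mem_centreVars m a a'),
    cgen _ (Sum.inr a') (inr_right_mem_centreVars m a a')}

/-- `t_a/t_a = 1`. [folklore] -/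
theorem cgen_self :
    (cgen (MvPowerSeries.X (Sum.inr a)) (Sum.inr a) (inr_left_mem_centreVars m a a') : 𝚃) = 1 :=
  blowupAlgebra.gen_self _ _ _

/-- **`P[𝔓/t_a]` is generated over `P` by `u', v', t_{a'}'`** ("coordinates
`u, v, t₁, …, t_{d-1}, u', v', t₂'`"): the affine blowup algebra is generated by the `x/t_a`,
`x ∈ 𝔓 = (u, v, t_a, t_{a'})`, and `x/t_a` is a `P`-linear combination of `u/t_a, v/t_a, 1,
t_{a'}/t_a`. [cite: DeJong1996, 4.27, p. 76] -/
theorem adjoin_chartGens_eq_top : Algebra.adjoin 𝙿 (chartGens k m a a') = ⊤ := by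
  classical
  -- compare inside `P[1/t_a]` through the injective `val`
  apply Subalgebra.map_injective (f := (blowupAlgebra (nodalCentrePreimage k m a a')
    (MvPowerSeries.X (Sum.inr a) : 𝙿)).val) Subtype.val_injective
  rw [AlgHom.map_adjoin, Algebra.map_top, Subalgebra.range_val]
  apply le_antisymm
  · exact Algebra.adjoin_le (by rintro _ ⟨z, -, rfl⟩; exact z.2)
  · -- the defining generators `x/t_a`, `x ∈ 𝔓`, lie in the adjoin of the three
    change Algebra.adjoin 𝙿 (blowupAlgebraGens _ _) ≤ _
    refine Algebra.adjoin_le ?_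
    rintro _ ⟨x, hx, rfl⟩
    -- induction on `x ∈ 𝔓 = span (X '' centreVars)`
    set S : Subalgebra 𝙿 (Localization.Away (MvPowerSeries.X (Sum.inr a) : 𝙿)) :=
      Algebra.adjoin 𝙿 ((blowupAlgebra (nodalCentrePreimage k m a a')
        (MvPowerSeries.X (Sum.inr a) : 𝙿)).val '' chartGens k m a a') with hS
    change x ∈ Ideal.span _ at hx
    refine Submodule.span_induction (p := fun x _ =>
      algebraMap 𝙿 (Localization.Away (MvPowerSeries.X (Sum.inr a) : 𝙿)) x *
        Away.invSelf (MvPowerSeries.X (Sum.inr a) : 𝙿) ∈ S) ?_ ?_ ?_ ?_ hx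
    · rintro _ ⟨c, hc, rfl⟩
      have hc' : c ∈ centreVars m a a' := hc
      simp only [centreVars, Finset.mem_insert, Finset.mem_singleton] at hc'
      rcases hc' with rfl | rfl | rfl | rfl
      · exact Algebra.subset_adjoin ⟨_, Or.inl rfl, rfl⟩
      · exact Algebra.subset_adjoin ⟨_, Or.inr (Or.inl rfl), rfl⟩
      · rw [Away.mul_invSelf]
        exact one_mem S
      · exact Algebra.subset_adjoin ⟨_, Or.inr (Or.inr rfl), rfl⟩
    · rw [map_zero, zero_mul]
      exact zero_mem S
    · intro x y _ _ hx hy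
      rw [map_add, add_mul]
      exact add_mem hx hy
    · intro r x _ hx
      rw [smul_eq_mul, map_mul, mul_assoc]
      exact S.mul_mem (S.algebraMap_mem r) hx

/-- Induction principle: a property of elements of `P[𝔓/t_a]` stable under `+`, `*`, holding on
`P` and on `u', v', t_{a'}'` holds everywhere. [folklore] -/
theorem chartRing_induction {p : 𝚃 → Prop}
    (halg : ∀ r : 𝙿, p (algebraMap 𝙿 𝚃 r))
    (hu : p (cgen _ (Sum.inl 0) (inl_zero_mem_centreVars m a a')))
    (hv : p (cgen _ (Sum.inl 1) (inl_one_mem_centreVars m a a')))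
    (ha' : p (cgen _ (Sum.inr a') (inr_right_mem_centreVars m a a')))
    (hadd : ∀ x y, p x → p y → p (x + y)) (hmul : ∀ x y, p x → p y → p (x * y)) (z : 𝚃) : p z := by
  have hz : z ∈ Algebra.adjoin 𝙿 (chartGens k m a a') := by
    rw [adjoin_chartGens_eq_top]; trivial
  refine Algebra.adjoin_induction (p := fun z _ => p z) ?_ halg (fun x y _ _ => hadd x y)
    (fun x y _ _ => hmul x y) hz
  rintro x (rfl | rfl | rfl)
  exacts [hu, hv, ha']

/-! ## The base primes `𝔓_{pq}` and membership of variables -/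

variable {m} in
/-- `t_d ∉ 𝔓_{pq}` for `d ∉ {p, q}`. [folklore] -/
theorem X_inr_notMem_nodalCentrePreimage {p q d : Fin m} (hp : d ≠ p) (hq : d ≠ q) :
    (MvPowerSeries.X (Sum.inr d) : 𝙿) ∉ nodalCentrePreimage k m p q := by
  rw [X_mem_nodalCentrePreimage_iff]
  simp only [centreVars, Finset.mem_insert, reduceCtorEq, Sum.inr.injEq, Finset.mem_singleton,
    false_or, not_or]
  exact ⟨hp, hq⟩

variable {m} in
/-- The ideal `(X_c : c ∈ C)` of `k⟦u, v, t⟧` is prime, for any finite set `C` of variables.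
[folklore] -/
theorem isPrime_span_X_image_finset (C : Finset (Fin 2 ⊕ Fin m)) :
    (Ideal.span ((fun c => (MvPowerSeries.X c : 𝙿)) '' (C : Set (Fin 2 ⊕ Fin m)))).IsPrime := by
  haveI : IsDomain 𝙿 := NoZeroDivisors.to_isDomain _
  refine MvPowerSeries.isPrime_span_X_image
    (Function.Embedding.subtype fun c : Fin 2 ⊕ Fin m => c ∉ C) C fun c => ?_
  constructor
  · rintro hc ⟨⟨c', hc'⟩, rfl⟩
    exact hc' hc
  · intro hc
    by_contra h
    exact hc ⟨⟨c, h⟩, rfl⟩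

variable {m} in
/-- A variable outside `C` is not in `(X_c : c ∈ C)` (kill the variables of `C`). [folklore] -/
theorem X_notMem_span_X_image_finset (C : Finset (Fin 2 ⊕ Fin m)) {d : Fin 2 ⊕ Fin m}
    (hd : d ∉ C) :
    (MvPowerSeries.X d : 𝙿) ∉
      Ideal.span ((fun c => (MvPowerSeries.X c : 𝙿)) '' (C : Set (Fin 2 ⊕ Fin m))) := by
  classical
  intro h
  let τ := {c : Fin 2 ⊕ Fin m // c ∉ C}
  let e : τ ↪ Fin 2 ⊕ Fin m := Function.Embedding.subtype _
  have hC : ∀ c, c ∈ C ↔ c ∉ Set.range e := by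
    intro c
    constructor
    · rintro hc ⟨⟨c', hc'⟩, rfl⟩
      exact hc' hc
    · intro hc
      by_contra h'
      exact hc ⟨⟨c, h'⟩, rfl⟩
  have hker := MvPowerSeries.ker_killCompl_eq_span (R := k) e C hC
  have h1 : (MvPowerSeries.X d : 𝙿) ∈ RingHom.ker (MvPowerSeries.killCompl (R := k) e).toRingHom := by
    rw [hker]; exact h
  rw [RingHom.mem_ker] at h1
  have h2 : MvPowerSeries.killCompl (R := k) e (MvPowerSeries.X (e ⟨d, hd⟩)) =
      MvPowerSeries.X ⟨d, hd⟩ := MvPowerSeries.killCompl_X _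
  change MvPowerSeries.killCompl e (MvPowerSeries.X d) = 0 at h1
  rw [show (e ⟨d, hd⟩ : Fin 2 ⊕ Fin m) = d from rfl, h1] at h2
  have h3 := congrArg (MvPowerSeries.coeff (Finsupp.single (⟨d, hd⟩ : τ) 1)) h2
  simp [MvPowerSeries.coeff_X] at h3

/-- **`t_{a'}` is a non-zero-divisor modulo `t_a` in `P/𝔓_{cc'}`**: if `t_a ∣ t_{a'} x` in
`P/𝔓_{cc'}` then `t_a ∣ x` — because `𝔓_{cc'} + (t_a) = (u, v, t_c, t_{c'}, t_a)` is a prime of `P`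
not containing `t_{a'}` (`a' ∉ {c, c', a}`). [folklore] -/
theorem dvd_of_dvd_mul_quotient {c c' : Fin m} (ha'c : a' ≠ c) (ha'c' : a' ≠ c') (haa' : a ≠ a')
    (x : 𝙿 ⧸ nodalCentrePreimage k m c c')
    (h : Ideal.Quotient.mk _ (MvPowerSeries.X (Sum.inr a)) ∣
      Ideal.Quotient.mk _ (MvPowerSeries.X (Sum.inr a')) * x) :
    Ideal.Quotient.mk (nodalCentrePreimage k m c c') (MvPowerSeries.X (Sum.inr a)) ∣ x := by
  classical
  -- the prime `𝔔 = (u, v, t_c, t_{c'}, t_a)` of `P`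
  set C5 : Finset (Fin 2 ⊕ Fin m) := insert (Sum.inr a) (centreVars m c c') with hC5
  set 𝔔 : Ideal 𝙿 := Ideal.span ((fun c => (MvPowerSeries.X c : 𝙿)) '' (C5 : Set (Fin 2 ⊕ Fin m)))
    with h𝔔
  haveI h𝔔p : 𝔔.IsPrime := isPrime_span_X_image_finset k C5
  have hle : nodalCentrePreimage k m c c' ≤ 𝔔 :=
    Ideal.span_mono (Set.image_mono (by rw [hC5]; exact_mod_cast Finset.subset_insert _ _))
  have hta : (MvPowerSeries.X (Sum.inr a) : 𝙿) ∈ 𝔔 :=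
    Ideal.subset_span ⟨Sum.inr a, by simp [hC5], rfl⟩
  have hta' : (MvPowerSeries.X (Sum.inr a') : 𝙿) ∉ 𝔔 := by
    refine X_notMem_span_X_image_finset k C5 ?_
    simp only [hC5, Finset.mem_insert, Sum.inr.injEq, centreVars, Finset.mem_singleton,
      reduceCtorEq, false_or, not_or]
    exact ⟨fun h => haa' h.symm, ha'c, ha'c'⟩
  -- `𝔔 = (𝔓_{cc'} + (t_a))`: an element of `P` that is `t_a y + z`, `z ∈ 𝔓_{cc'}`, lies in `𝔔`,
  -- and conversely membership in `𝔔` modulo `𝔓_{cc'}` is divisibility by `t_a`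
  obtain ⟨x, rfl⟩ := Ideal.Quotient.mk_surjective x
  obtain ⟨y, hy⟩ := h
  obtain ⟨y, rfl⟩ := Ideal.Quotient.mk_surjective y
  -- `t_{a'} x - t_a y ∈ 𝔓_{cc'} ⊆ 𝔔`, so `t_{a'} x ∈ 𝔔`, so `x ∈ 𝔔`
  have h1 : MvPowerSeries.X (Sum.inr a') * x - MvPowerSeries.X (Sum.inr a) * y ∈
      nodalCentrePreimage k m c c' := by
    rw [← Ideal.Quotient.eq, map_mul, map_mul]
    exact hy
  have hx𝔔 : x ∈ 𝔔 := by
    have h2 : MvPowerSeries.X (Sum.inr a') * x ∈ 𝔔 := by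
      have := 𝔔.add_mem (hle h1) (𝔔.mul_mem_right y hta)
      rwa [sub_add_cancel] at this
    exact ((Ideal.IsPrime.mem_or_mem h𝔔p h2).resolve_left hta')
  -- membership in `𝔔`: `x = t_a w + z` with `z ∈ 𝔓_{cc'}`
  have hsplit : ∀ z ∈ 𝔔, ∃ w, z - MvPowerSeries.X (Sum.inr a) * w ∈ nodalCentrePreimage k m c c' := by
    intro z hz
    refine Submodule.span_induction (p := fun z _ =>
      ∃ w, z - MvPowerSeries.X (Sum.inr a) * w ∈ nodalCentrePreimage k m c c') ?_ ?_ ?_ ?_ hz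
    · rintro _ ⟨d, hd, rfl⟩
      have hd' : d ∈ C5 := hd
      rw [hC5, Finset.mem_insert] at hd'
      rcases hd' with rfl | hd'
      · exact ⟨1, by simp⟩
      · exact ⟨0, by simpa using X_mem_nodalCentrePreimage k hd'⟩
    · exact ⟨0, by simp⟩
    · rintro z₁ z₂ - - ⟨w₁, hw₁⟩ ⟨w₂, hw₂⟩
      exact ⟨w₁ + w₂, by
        have := Ideal.add_mem _ hw₁ hw₂
        convert this using 1; ring⟩
    · rintro r z - ⟨w, hw⟩
      exact ⟨r * w, by
        have := Ideal.mul_mem_left _ r hw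
        convert this using 1
        rw [smul_eq_mul]; ring⟩
  obtain ⟨w, hw⟩ := hsplit x hx𝔔
  refine ⟨Ideal.Quotient.mk _ w, ?_⟩
  rw [← map_mul, eq_comm, Ideal.Quotient.eq,
    show MvPowerSeries.X (Sum.inr a) * w - x = -(x - MvPowerSeries.X (Sum.inr a) * w) by ring]
  exact neg_mem_iff.mpr hw

/-! ## The test maps of the chart `t_a ≠ 0` -/

section Test

variable {p q : Fin m}

/-- `t_a` is a unit in `Frac(P/𝔓_{pq})` when `a ∉ {p, q}`. [folklore] -/
theorem isUnit_algebraMap_X (hp : a ≠ p) (hq : a ≠ q) :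
    IsUnit ((algebraMap (𝙿 ⧸ nodalCentrePreimage k m p q)
      (FractionRing (𝙿 ⧸ nodalCentrePreimage k m p q))).comp (Ideal.Quotient.mk _)
        (MvPowerSeries.X (Sum.inr a) : 𝙿)) := by
  haveI := isPrime_nodalCentrePreimage k m p q
  rw [RingHom.comp_apply, isUnit_iff_ne_zero, map_ne_zero_iff _ (IsFractionRing.injective _ _),
    Ne, Ideal.Quotient.eq_zero_iff_mem]
  exact X_inr_notMem_nodalCentrePreimage k hp hq

/-- The test map `θ_{pq} : P[𝔓/t_a] → Frac(P/𝔓_{pq})` induced by `P → P/𝔓_{pq}` (`a ∉ {p, q}`).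
[folklore] -/
def chartTest (hp : a ≠ p) (hq : a ≠ q) : 𝚃 →+* FractionRing (𝙿 ⧸ nodalCentrePreimage k m p q) :=
  blowupAlgebra.testHom (nodalCentrePreimage k m a a') (MvPowerSeries.X (Sum.inr a) : 𝙿)
    ((algebraMap (𝙿 ⧸ nodalCentrePreimage k m p q)
      (FractionRing (𝙿 ⧸ nodalCentrePreimage k m p q))).comp (Ideal.Quotient.mk _))
    (isUnit_algebraMap_X k m a hp hq)

/-- `θ_{pq}` on `P`. [folklore] -/
theorem chartTest_algebraMap (hp : a ≠ p) (hq : a ≠ q) (r : 𝙿) :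
    chartTest k m a a' hp hq (algebraMap 𝙿 𝚃 r) =
      algebraMap (𝙿 ⧸ nodalCentrePreimage k m p q) (FractionRing (𝙿 ⧸ nodalCentrePreimage k m p q))
        (Ideal.Quotient.mk (nodalCentrePreimage k m p q) r) :=
  blowupAlgebra.testHom_algebraMap _ _ _ _ r

/-- `θ_{pq}` kills `P`-elements of `𝔓_{pq}`. [folklore] -/
theorem chartTest_algebraMap_eq_zero (hp : a ≠ p) (hq : a ≠ q) {r : 𝙿}
    (hr : r ∈ nodalCentrePreimage k m p q) : chartTest k m a a' hp hq (algebraMap 𝙿 𝚃 r) = 0 := by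
  rw [chartTest_algebraMap, Ideal.Quotient.eq_zero_iff_mem.mpr hr, map_zero]

/-- `θ_{pq}` kills `x/t_a` when `x ∈ 𝔓_{pq}`. [folklore] -/
theorem chartTest_cgen_eq_zero (hp : a ≠ p) (hq : a ≠ q) {c : Fin 2 ⊕ Fin m}
    (hc : c ∈ centreVars m a a') (hcpq : (MvPowerSeries.X c : 𝙿) ∈ nodalCentrePreimage k m p q) :
    chartTest k m a a' hp hq (cgen _ c hc) = 0 :=
  blowupAlgebra.testHom_gen_eq_zero _ _ _ _ _ (by
    rw [RingHom.comp_apply, Ideal.Quotient.eq_zero_iff_mem.mpr hcpq, map_zero])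

/-- The kernel of `θ_{pq}` is prime and does not contain `t_a`. [folklore] -/
theorem isPrime_ker_chartTest (hp : a ≠ p) (hq : a ≠ q) :
    (RingHom.ker (chartTest k m a a' hp hq)).IsPrime ∧
      algebraMap 𝙿 𝚃 (MvPowerSeries.X (Sum.inr a)) ∉ RingHom.ker (chartTest k m a a' hp hq) := by
  haveI := isPrime_nodalCentrePreimage k m p q
  refine ⟨RingHom.ker_isPrime _, ?_⟩
  rw [RingHom.mem_ker, chartTest_algebraMap]
  exact (isUnit_algebraMap_X k m a hp hq).ne_zero

end Test

/-! ## The prime `(u', v', t_{a'}', t_c)` — "`u' = v' = t₂' = t₃ = 0`" -/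

/-- The ideal `(u', v', t_{a'}', t_c)` of `P[𝔓/t_a]`: the component "`u' = v' = t₂' = t₃ = 0`" of
the singular locus of the chart `t_a ≠ 0` (which "maps onto `u = v = t₂ = t₃ = 0`").
[cite: DeJong1996, 4.27, p. 76] -/
def idealA (c : Fin m) : Ideal 𝚃 :=
  Ideal.span {cgen _ (Sum.inl 0) (inl_zero_mem_centreVars m a a'),
    cgen _ (Sum.inl 1) (inl_one_mem_centreVars m a a'),
    cgen _ (Sum.inr a') (inr_right_mem_centreVars m a a'),
    algebraMap 𝙿 𝚃 (MvPowerSeries.X (Sum.inr c))}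

section IdealA

variable {c : Fin m}

/-- `u' ∈ (u', v', t_{a'}', t_c)`. [folklore] -/
theorem cgen_inl_zero_mem_idealA :
    cgen _ (Sum.inl 0) (inl_zero_mem_centreVars m a a') ∈ idealA k m a a' c :=
  Ideal.subset_span (by simp)

/-- `v' ∈ (u', v', t_{a'}', t_c)`. [folklore] -/
theorem cgen_inl_one_mem_idealA :
    cgen _ (Sum.inl 1) (inl_one_mem_centreVars m a a') ∈ idealA k m a a' c :=
  Ideal.subset_span (by simp)

/-- `t_{a'}' ∈ (u', v', t_{a'}', t_c)`. [folklore] -/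
theorem cgen_inr_mem_idealA :
    cgen _ (Sum.inr a') (inr_right_mem_centreVars m a a') ∈ idealA k m a a' c :=
  Ideal.subset_span (by simp)

/-- `t_c ∈ (u', v', t_{a'}', t_c)`. [folklore] -/
theorem algebraMap_X_mem_idealA :
    algebraMap 𝙿 𝚃 (MvPowerSeries.X (Sum.inr c)) ∈ idealA k m a a' c :=
  Ideal.subset_span (by simp)

/-- `𝔓_{a'c} · P[𝔓/t_a] ⊆ (u', v', t_{a'}', t_c)`: `u = t_a u'`, `v = t_a v'`, `t_{a'} = t_a t_{a'}'`.
[cite: DeJong1996, 4.27, p. 76] -/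
theorem map_nodalCentrePreimage_le_idealA :
    (nodalCentrePreimage k m a' c).map (algebraMap 𝙿 𝚃) ≤ idealA k m a a' c := by
  rw [Ideal.map_le_iff_le_comap]
  change Ideal.span _ ≤ _
  rw [Ideal.span_le]
  rintro _ ⟨d, hd, rfl⟩
  have hd' : d ∈ centreVars m a' c := hd
  simp only [centreVars, Finset.mem_insert, Finset.mem_singleton] at hd'
  rw [SetLike.mem_coe, Ideal.mem_comap]
  rcases hd' with rfl | rfl | rfl | rfl
  · rw [← blowupAlgebra.algebraMap_mul_gen _ _ _
      (X_mem_nodalCentrePreimage k (inl_zero_mem_centreVars m a a'))]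
    exact Ideal.mul_mem_left _ _ (cgen_inl_zero_mem_idealA k m a a')
  · rw [← blowupAlgebra.algebraMap_mul_gen _ _ _
      (X_mem_nodalCentrePreimage k (inl_one_mem_centreVars m a a'))]
    exact Ideal.mul_mem_left _ _ (cgen_inl_one_mem_idealA k m a a')
  · rw [← blowupAlgebra.algebraMap_mul_gen _ _ _
      (X_mem_nodalCentrePreimage k (inr_right_mem_centreVars m a a'))]
    exact Ideal.mul_mem_left _ _ (cgen_inr_mem_idealA k m a a')
  · exact algebraMap_X_mem_idealA k m a a'

/-- The strict transform `F_t = u'v' - t_{a'}' ∏''` lies in `(u', v', t_{a'}', t_c)`.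
[cite: DeJong1996, 4.27, p. 76] -/
theorem strictTransformT_mem_idealA : strictTransformT k m s a a' ∈ idealA k m a a' c := by
  rw [strictTransformT]
  refine Ideal.sub_mem _ (Ideal.mul_mem_right _ _ (cgen_inl_zero_mem_idealA k m a a')) ?_
  exact Ideal.mul_mem_right _ _ (cgen_inr_mem_idealA k m a a')

/-- `P → P[𝔓/t_a]/(u', v', t_{a'}', t_c)` is onto: the generators `u', v', t_{a'}'` die.
[folklore] -/
theorem mk_idealA_comp_algebraMap_surjective :
    Function.Surjective ((Ideal.Quotient.mk (idealA k m a a' c)).comp (algebraMap 𝙿 𝚃)) := by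
  intro z
  obtain ⟨z, rfl⟩ := Ideal.Quotient.mk_surjective z
  refine chartRing_induction k m a a' (p := fun z => ∃ r, ((Ideal.Quotient.mk (idealA k m a a' c)).comp
    (algebraMap 𝙿 𝚃)) r = Ideal.Quotient.mk _ z) (fun r => ⟨r, rfl⟩) ?_ ?_ ?_ ?_ ?_ z
  · exact ⟨0, by rw [map_zero, eq_comm, Ideal.Quotient.eq_zero_iff_mem]; exact cgen_inl_zero_mem_idealA k m a a'⟩
  · exact ⟨0, by rw [map_zero, eq_comm, Ideal.Quotient.eq_zero_iff_mem]; exact cgen_inl_one_mem_idealA k m a a'⟩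
  · exact ⟨0, by rw [map_zero, eq_comm, Ideal.Quotient.eq_zero_iff_mem]; exact cgen_inr_mem_idealA k m a a'⟩
  · rintro x y ⟨r₁, h₁⟩ ⟨r₂, h₂⟩
    exact ⟨r₁ + r₂, by rw [map_add, h₁, h₂, map_add]⟩
  · rintro x y ⟨r₁, h₁⟩ ⟨r₂, h₂⟩
    exact ⟨r₁ * r₂, by rw [map_mul, h₁, h₂, map_mul]⟩

variable (c) in
/-- **`(u', v', t_{a'}', t_c)` is the kernel of the test map `θ_{a'c}`** (for `a ∉ {a', c}`): the
ideal is killed by `θ_{a'c}`, and `P ↠ P[𝔓/t_a]/(u', v', t_{a'}', t_c) → Frac(P/𝔓_{a'c})` is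
`P → P/𝔓_{a'c} ↪ Frac`, whose kernel `𝔓_{a'c}` already dies in the quotient. [cite: DeJong1996, 4.27, p. 76] -/
theorem ker_chartTest_eq_idealA (haa' : a ≠ a') (hac : a ≠ c) :
    RingHom.ker (chartTest k m a a' haa' hac) = idealA k m a a' c := by
  haveI := isPrime_nodalCentrePreimage k m a' c
  apply le_antisymm
  · intro z hz
    obtain ⟨r, hr⟩ := mk_idealA_comp_algebraMap_surjective k m a a' (c := c) (Ideal.Quotient.mk _ z)
    rw [RingHom.comp_apply, Ideal.Quotient.eq] at hr
    -- `z = algebraMap r + (z - algebraMap r)` with the second term in the ideal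
    have hz' : chartTest k m a a' haa' hac (algebraMap 𝙿 𝚃 r) = 0 := by
      have h1 : algebraMap 𝙿 𝚃 r - z ∈ RingHom.ker (chartTest k m a a' haa' hac) := by
        refine (show idealA k m a a' c ≤ RingHom.ker (chartTest k m a a' haa' hac) from ?_) hr
        rw [idealA, Ideal.span_le]
        rintro x hx
        simp only [Set.mem_insert_iff, Set.mem_singleton_iff] at hx
        rw [SetLike.mem_coe, RingHom.mem_ker]
        rcases hx with rfl | rfl | rfl | rfl
        · exact chartTest_cgen_eq_zero k m a a' haa' hac _ (X_mem_nodalCentrePreimage k (by simp [centreVars]))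
        · exact chartTest_cgen_eq_zero k m a a' haa' hac _ (X_mem_nodalCentrePreimage k (by simp [centreVars]))
        · exact chartTest_cgen_eq_zero k m a a' haa' hac _ (X_mem_nodalCentrePreimage k (by simp [centreVars]))
        · exact chartTest_algebraMap_eq_zero k m a a' haa' hac (X_mem_nodalCentrePreimage k (by simp [centreVars]))
      rw [RingHom.mem_ker, map_sub, RingHom.mem_ker.mp hz, sub_zero] at h1
      exact h1
    rw [chartTest_algebraMap, map_eq_zero_iff _ (IsFractionRing.injective _ _),
      Ideal.Quotient.eq_zero_iff_mem] at hz'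
    have h2 : algebraMap 𝙿 𝚃 r ∈ idealA k m a a' c :=
      map_nodalCentrePreimage_le_idealA k m a a' (Ideal.mem_map_of_mem _ hz')
    have := Ideal.sub_mem _ h2 hr
    rwa [sub_sub_cancel] at this
  · rw [idealA, Ideal.span_le]
    rintro x hx
    simp only [Set.mem_insert_iff, Set.mem_singleton_iff] at hx
    rw [SetLike.mem_coe, RingHom.mem_ker]
    rcases hx with rfl | rfl | rfl | rfl
    · exact chartTest_cgen_eq_zero k m a a' haa' hac _ (X_mem_nodalCentrePreimage k (by simp [centreVars]))
    · exact chartTest_cgen_eq_zero k m a a' haa' hac _ (X_mem_nodalCentrePreimage k (by simp [centreVars]))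
    · exact chartTest_cgen_eq_zero k m a a' haa' hac _ (X_mem_nodalCentrePreimage k (by simp [centreVars]))
    · exact chartTest_algebraMap_eq_zero k m a a' haa' hac (X_mem_nodalCentrePreimage k (by simp [centreVars]))

variable (c) in
/-- **`(u', v', t_{a'}', t_c)` is a prime ideal of `P[𝔓/t_a]` not containing `t_a`** (for
`a ∉ {a', c}`): the component "`u' = v' = t_{a'}' = t_c = 0`" of the singular locus of the chart is
irreducible and not contained in the exceptional divisor. [cite: DeJong1996, 4.27, p. 76] -/
theorem isPrime_idealA (haa' : a ≠ a') (hac : a ≠ c) :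
    (idealA k m a a' c).IsPrime ∧ algebraMap 𝙿 𝚃 (MvPowerSeries.X (Sum.inr a)) ∉ idealA k m a a' c := by
  rw [← ker_chartTest_eq_idealA k m a a' c haa' hac]
  exact isPrime_ker_chartTest k m a a' haa' hac

end IdealA

/-! ## The prime `(u', v', t_c, t_{c'})` — "`u' = v' = t₃ = t₄ = 0`" -/

/-- The ideal `(u', v', t_c, t_{c'})` of `P[𝔓/t_a]`: the component "`u' = v' = t₃ = t₄ = 0`" of
the singular locus of the chart `t_a ≠ 0`, "the strict transform of the component
`u = v = t₃ = t₄ = 0`". [cite: DeJong1996, 4.27, p. 76] -/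
def idealB (c c' : Fin m) : Ideal 𝚃 :=
  Ideal.span {cgen _ (Sum.inl 0) (inl_zero_mem_centreVars m a a'),
    cgen _ (Sum.inl 1) (inl_one_mem_centreVars m a a'),
    algebraMap 𝙿 𝚃 (MvPowerSeries.X (Sum.inr c)),
    algebraMap 𝙿 𝚃 (MvPowerSeries.X (Sum.inr c'))}

section IdealB

variable {c c' : Fin m}

/-- `u' ∈ (u', v', t_c, t_{c'})`. [folklore] -/
theorem cgen_inl_zero_mem_idealB :
    cgen _ (Sum.inl 0) (inl_zero_mem_centreVars m a a') ∈ idealB k m a a' c c' :=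
  Ideal.subset_span (by simp)

/-- `v' ∈ (u', v', t_c, t_{c'})`. [folklore] -/
theorem cgen_inl_one_mem_idealB :
    cgen _ (Sum.inl 1) (inl_one_mem_centreVars m a a') ∈ idealB k m a a' c c' :=
  Ideal.subset_span (by simp)

/-- `t_c ∈ (u', v', t_c, t_{c'})`. [folklore] -/
theorem algebraMap_X_left_mem_idealB :
    algebraMap 𝙿 𝚃 (MvPowerSeries.X (Sum.inr c)) ∈ idealB k m a a' c c' :=
  Ideal.subset_span (by simp)

/-- `t_{c'} ∈ (u', v', t_c, t_{c'})`. [folklore] -/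
theorem algebraMap_X_right_mem_idealB :
    algebraMap 𝙿 𝚃 (MvPowerSeries.X (Sum.inr c')) ∈ idealB k m a a' c c' :=
  Ideal.subset_span (by simp)

/-- `𝔓_{cc'} · P[𝔓/t_a] ⊆ (u', v', t_c, t_{c'})`. [cite: DeJong1996, 4.27, p. 76] -/
theorem map_nodalCentrePreimage_le_idealB :
    (nodalCentrePreimage k m c c').map (algebraMap 𝙿 𝚃) ≤ idealB k m a a' c c' := by
  rw [Ideal.map_le_iff_le_comap]
  change Ideal.span _ ≤ _
  rw [Ideal.span_le]
  rintro _ ⟨d, hd, rfl⟩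
  have hd' : d ∈ centreVars m c c' := hd
  simp only [centreVars, Finset.mem_insert, Finset.mem_singleton] at hd'
  rw [SetLike.mem_coe, Ideal.mem_comap]
  rcases hd' with rfl | rfl | rfl | rfl
  · rw [← blowupAlgebra.algebraMap_mul_gen _ _ _
      (X_mem_nodalCentrePreimage k (inl_zero_mem_centreVars m a a'))]
    exact Ideal.mul_mem_left _ _ (cgen_inl_zero_mem_idealB k m a a')
  · rw [← blowupAlgebra.algebraMap_mul_gen _ _ _
      (X_mem_nodalCentrePreimage k (inl_one_mem_centreVars m a a'))]
    exact Ideal.mul_mem_left _ _ (cgen_inl_one_mem_idealB k m a a')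
  · exact algebraMap_X_left_mem_idealB k m a a'
  · exact algebraMap_X_right_mem_idealB k m a a'

/-- The strict transform `F_t = u'v' - t_{a'}' ∏''` lies in `(u', v', t_c, t_{c'})` when `t_c`
divides `∏''` (`c ∈ restIdx`). [cite: DeJong1996, 4.27, p. 76] -/
theorem strictTransformT_mem_idealB (hc : c ∈ restIdx m s a a') :
    strictTransformT k m s a a' ∈ idealB k m a a' c c' := by
  classical
  rw [strictTransformT]
  refine Ideal.sub_mem _ (Ideal.mul_mem_right _ _ (cgen_inl_zero_mem_idealB k m a a')) ?_
  refine Ideal.mul_mem_left _ _ ?_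
  rw [restProd, ← Finset.mul_prod_erase _ _ hc, map_mul]
  exact Ideal.mul_mem_right _ _ (algebraMap_X_left_mem_idealB k m a a')

/-- `(P/𝔓_{cc'})[Y] → P[𝔓/t_a]/(u', v', t_c, t_{c'})`, `Y ↦ t_{a'}'`, is onto: `u', v'` die and
`t_{a'}'` is hit by `Y`. [folklore] -/
theorem mk_idealB_comp_aeval_surjective :
    Function.Surjective ((Ideal.Quotient.mk (idealB k m a a' c c')).comp
      (Polynomial.aeval (cgen _ (Sum.inr a') (inr_right_mem_centreVars m a a')) :
        𝙿[X] →ₐ[𝙿] 𝚃).toRingHom) := by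
  intro z
  obtain ⟨z, rfl⟩ := Ideal.Quotient.mk_surjective z
  refine chartRing_induction k m a a' (p := fun z => ∃ r : 𝙿[X],
    ((Ideal.Quotient.mk (idealB k m a a' c c')).comp (Polynomial.aeval
      (cgen _ (Sum.inr a') (inr_right_mem_centreVars m a a')) : 𝙿[X] →ₐ[𝙿] 𝚃).toRingHom) r =
        Ideal.Quotient.mk _ z) ?_ ?_ ?_ ?_ ?_ ?_ z
  · intro r
    exact ⟨Polynomial.C r, by simp⟩
  · exact ⟨0, by
      rw [map_zero, eq_comm, Ideal.Quotient.eq_zero_iff_mem]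
      exact cgen_inl_zero_mem_idealB k m a a'⟩
  · exact ⟨0, by
      rw [map_zero, eq_comm, Ideal.Quotient.eq_zero_iff_mem]
      exact cgen_inl_one_mem_idealB k m a a'⟩
  · exact ⟨Polynomial.X, by simp⟩
  · rintro x y ⟨r₁, h₁⟩ ⟨r₂, h₂⟩
    exact ⟨r₁ + r₂, by rw [map_add, h₁, h₂, map_add]⟩
  · rintro x y ⟨r₁, h₁⟩ ⟨r₂, h₂⟩
    exact ⟨r₁ * r₂, by rw [map_mul, h₁, h₂, map_mul]⟩

variable (c c') in
/-- **`(u', v', t_c, t_{c'})` is the kernel of the test map `θ_{cc'}`** (for `a, a' ∉ {c, c'}`,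
`a ≠ a'`): modulo the ideal, `P[𝔓/t_a]` is a quotient of `(P/𝔓_{cc'})[Y]` (`Y ↦ t_{a'}'`) by an
ideal containing `t_a Y - t_{a'}`; composed with `θ_{cc'}` this is `Y ↦ t_{a'}/t_a` into
`Frac(P/𝔓_{cc'})`, whose kernel is `(t_a Y - t_{a'})` since `t_{a'}` is a non-zero-divisor modulo
`t_a` (`Polynomial.mem_span_C_mul_X_sub_C_of_aeval_div_eq_zero`). [cite: DeJong1996, 4.27, p. 76] -/
theorem ker_chartTest_eq_idealB (haa' : a ≠ a') (hac : a ≠ c) (hac' : a ≠ c') (ha'c : a' ≠ c)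
    (ha'c' : a' ≠ c') :
    RingHom.ker (chartTest k m a a' hac hac') = idealB k m a a' c c' := by
  haveI := isPrime_nodalCentrePreimage k m c c'
  -- notation
  set D := 𝙿 ⧸ nodalCentrePreimage k m c c' with hD
  set K := FractionRing D
  set θ := chartTest k m a a' hac hac' with hθ
  set α : D := Ideal.Quotient.mk _ (MvPowerSeries.X (Sum.inr a)) with hα
  set β : D := Ideal.Quotient.mk _ (MvPowerSeries.X (Sum.inr a')) with hβ
  set ta' : 𝚃 := cgen _ (Sum.inr a') (inr_right_mem_centreVars m a a') with hta'
  set ev : 𝙿[X] →+* 𝚃 := (Polynomial.aeval ta' : 𝙿[X] →ₐ[𝙿] 𝚃).toRingHom with hev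
  have hα0 : α ≠ 0 := by
    rw [hα, Ne, Ideal.Quotient.eq_zero_iff_mem]
    exact X_inr_notMem_nodalCentrePreimage k hac hac'
  have hαK : algebraMap D K α ≠ 0 := (map_ne_zero_iff _ (IsFractionRing.injective D K)).mpr hα0
  -- the easy inclusion
  have hle : idealB k m a a' c c' ≤ RingHom.ker θ := by
    rw [idealB, Ideal.span_le]
    rintro x hx
    simp only [Set.mem_insert_iff, Set.mem_singleton_iff] at hx
    rw [SetLike.mem_coe, RingHom.mem_ker]
    rcases hx with rfl | rfl | rfl | rfl
    · exact chartTest_cgen_eq_zero k m a a' hac hac' _ (X_mem_nodalCentrePreimage k (by simp [centreVars]))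
    · exact chartTest_cgen_eq_zero k m a a' hac hac' _ (X_mem_nodalCentrePreimage k (by simp [centreVars]))
    · exact chartTest_algebraMap_eq_zero k m a a' hac hac' (X_mem_nodalCentrePreimage k (by simp [centreVars]))
    · exact chartTest_algebraMap_eq_zero k m a a' hac hac' (X_mem_nodalCentrePreimage k (by simp [centreVars]))
  refine le_antisymm ?_ hle
  -- values of `θ ∘ ev`: `θ (ev r) = aeval (β/α) (map mk r)`
  have hθta' : θ ta' * algebraMap D K α = algebraMap D K β := by
    have := blowupAlgebra.testHom_gen_mul (nodalCentrePreimage k m a a') (MvPowerSeries.X (Sum.inr a) : 𝙿)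
      ((algebraMap D K).comp (Ideal.Quotient.mk _)) (isUnit_algebraMap_X k m a hac hac')
      (MvPowerSeries.X (Sum.inr a')) (X_mem_nodalCentrePreimage k (inr_right_mem_centreVars m a a'))
    exact this
  have hθta'2 : θ ta' = algebraMap D K β / algebraMap D K α := by
    rw [eq_div_iff hαK, hθta']
  have hθev : ∀ r : 𝙿[X], θ (ev r) = Polynomial.aeval (algebraMap D K β / algebraMap D K α)
      (Polynomial.map (Ideal.Quotient.mk (nodalCentrePreimage k m c c')) r) := by
    intro r
    rw [Polynomial.aeval_def, Polynomial.eval₂_map, hev, AlgHom.toRingHom_eq_coe, RingHom.coe_coe,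
      Polynomial.aeval_def, Polynomial.hom_eval₂, hθta'2]
    congr 1
    exact RingHom.ext fun x => chartTest_algebraMap k m a a' hac hac' x
  -- the hard inclusion
  intro z hz
  obtain ⟨r, hr⟩ := mk_idealB_comp_aeval_surjective k m a a' (c := c) (c' := c') (Ideal.Quotient.mk _ z)
  change Ideal.Quotient.mk _ (ev r) = Ideal.Quotient.mk _ z at hr
  rw [Ideal.Quotient.eq] at hr
  -- `ev r ∈ ker θ`
  have hr' : θ (ev r) = 0 := by
    have h1 : ev r - z ∈ RingHom.ker θ := hle hr
    rw [RingHom.mem_ker, map_sub, RingHom.mem_ker.mp hz, sub_zero] at h1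
    exact h1
  -- so `map mk r ∈ (α Y - β)` in `D[Y]`
  rw [hθev] at hr'
  have hmem : Polynomial.map (Ideal.Quotient.mk (nodalCentrePreimage k m c c')) r ∈
      Ideal.span {C α * X - C β} :=
    Polynomial.mem_span_C_mul_X_sub_C_of_aeval_div_eq_zero (K := K) hα0
      (fun x hx => dvd_of_dvd_mul_quotient k m a a' ha'c ha'c' haa' x hx) hr'
  obtain ⟨g, hg⟩ := Ideal.mem_span_singleton'.mp hmem
  obtain ⟨g, rfl⟩ := Polynomial.map_surjective _ Ideal.Quotient.mk_surjective g
  -- lift: `r - g (t_a Y - t_{a'})` has coefficients in `𝔓_{cc'}`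
  have hdiff : r - g * (C (MvPowerSeries.X (Sum.inr a)) * X - C (MvPowerSeries.X (Sum.inr a'))) ∈
      Ideal.map Polynomial.C (nodalCentrePreimage k m c c') := by
    rw [← Ideal.mk_ker (I := nodalCentrePreimage k m c c'), ← Polynomial.ker_mapRingHom,
      RingHom.mem_ker, Polynomial.coe_mapRingHom, Polynomial.map_sub, Polynomial.map_mul,
      Polynomial.map_sub, Polynomial.map_mul, Polynomial.map_C, Polynomial.map_X, Polynomial.map_C,
      ← hα, ← hβ, hg, sub_self]
  -- evaluate: `ev` kills `t_a Y - t_{a'}` and maps `𝔓_{cc'}[Y]` into the ideal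
  have hev1 : ev (C (MvPowerSeries.X (Sum.inr a)) * X - C (MvPowerSeries.X (Sum.inr a'))) = 0 := by
    rw [hev, AlgHom.toRingHom_eq_coe, RingHom.coe_coe, map_sub, map_mul, Polynomial.aeval_C,
      Polynomial.aeval_X, Polynomial.aeval_C, hta', blowupAlgebra.algebraMap_mul_gen, sub_self]
  have hev2 : ∀ w ∈ Ideal.map Polynomial.C (nodalCentrePreimage k m c c'), ev w ∈ idealB k m a a' c c' := by
    intro w hw
    rw [Ideal.map] at hw
    refine Submodule.span_induction (p := fun w _ => ev w ∈ idealB k m a a' c c') ?_ ?_ ?_ ?_ hw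
    · rintro _ ⟨x, hx, rfl⟩
      rw [hev, AlgHom.toRingHom_eq_coe, RingHom.coe_coe, Polynomial.aeval_C]
      exact map_nodalCentrePreimage_le_idealB k m a a' (Ideal.mem_map_of_mem _ hx)
    · rw [map_zero]; exact Ideal.zero_mem _
    · intro x y _ _ hx hy
      rw [map_add]; exact Ideal.add_mem _ hx hy
    · intro r x _ hx
      rw [smul_eq_mul, map_mul]; exact Ideal.mul_mem_left _ _ hx
  have hevr : ev r ∈ idealB k m a a' c c' := by
    have := hev2 _ hdiff
    rwa [map_sub, map_mul, hev1, mul_zero, sub_zero] at this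
  have := Ideal.sub_mem _ hevr hr
  rwa [sub_sub_cancel] at this

variable (c c') in
/-- **`(u', v', t_c, t_{c'})` is a prime ideal of `P[𝔓/t_a]` not containing `t_a`**
(`a, a' ∉ {c, c'}`, `a ≠ a'`): the component "`u' = v' = t₃ = t₄ = 0`" is irreducible and is the
strict transform of "`u = v = t₃ = t₄ = 0`". [cite: DeJong1996, 4.27, p. 76] -/
theorem isPrime_idealB (haa' : a ≠ a') (hac : a ≠ c) (hac' : a ≠ c') (ha'c : a' ≠ c) (ha'c' : a' ≠ c') :
    (idealB k m a a' c c').IsPrime ∧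
      algebraMap 𝙿 𝚃 (MvPowerSeries.X (Sum.inr a)) ∉ idealB k m a a' c c' := by
  rw [← ker_chartTest_eq_idealB k m a a' c c' haa' hac hac' ha'c ha'c']
  exact isPrime_ker_chartTest k m a a' hac hac'

end IdealB

/-! ## Singular points of the chart lie on the strict transform of some `V(𝔭_{pq})` -/

/-- **The singular points of the chart `t_a ≠ 0` lie on the strict transforms of the
`V(𝔭_{pq})`, `{p, q} ≠ {a, ·}`.** If `Q` is a prime of `P[𝔓/t_a]` into which every
`k`-derivation takes `F_t` (e.g. the preimage of a non-regular prime of `P[𝔓/t_a]/(F_t)`,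
Stacks 07PF), then `Q` contains a prime `𝔯` with `t_a ∉ 𝔯 ∋ F_t` and `𝔓_{pq} ⊆ 𝔯` for some
`p ≠ q`, both `< s` and `≠ a`: by the Jacobian conclusion
(`mem_of_forall_derivation_apply_mem_T`) `Q` contains `(u', v', t_{a'}', t_c)` or
`(u', v', t_c, t_{c'})`, which are such primes (`isPrime_idealA`, `isPrime_idealB`).
[cite: DeJong1996, 4.27, p. 76] -/
theorem exists_prime_le_of_forall_derivation_apply_mem (haa' : a ≠ a') (ha' : a'.val < s)
    (Q : Ideal 𝚃) [Q.IsPrime]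
    (hval : ∀ D : Derivation k 𝚃 𝚃, D (strictTransformT k m s a a') ∈ Q) :
    ∃ p q : Fin m, p ≠ q ∧ p.val < s ∧ q.val < s ∧ p ≠ a ∧ q ≠ a ∧
      ∃ 𝔯 : Ideal 𝚃, 𝔯.IsPrime ∧ 𝔯 ≤ Q ∧
        algebraMap 𝙿 𝚃 (MvPowerSeries.X (Sum.inr a)) ∉ 𝔯 ∧ strictTransformT k m s a a' ∈ 𝔯 ∧
          (nodalCentrePreimage k m p q).map (algebraMap 𝙿 𝚃) ≤ 𝔯 := by
  obtain ⟨hu, hv, c, hc, hcQ, hcase⟩ := mem_of_forall_derivation_apply_mem_T k m s a a' haa' Q hval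
  obtain ⟨hcs, hca, hca'⟩ := mem_restIdx_iff.mp hc
  rcases hcase with ha'Q | ⟨c', hc', hc'Q⟩
  · -- `(u', v', t_{a'}', t_c) ⊆ Q`
    obtain ⟨hprime, hnot⟩ := isPrime_idealA k m a a' c haa' (Ne.symm hca)
    refine ⟨a', c, Ne.symm hca', ha', hcs, Ne.symm haa', hca, idealA k m a a' c, hprime, ?_, hnot,
      strictTransformT_mem_idealA k m s a a', map_nodalCentrePreimage_le_idealA k m a a'⟩
    rw [idealA, Ideal.span_le]
    rintro x hx
    simp only [Set.mem_insert_iff, Set.mem_singleton_iff] at hx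
    rcases hx with rfl | rfl | rfl | rfl
    exacts [hu, hv, ha'Q, hcQ]
  · -- `(u', v', t_c, t_{c'}) ⊆ Q`
    obtain ⟨hc'c, hc'r⟩ := Finset.mem_erase.mp hc'
    obtain ⟨hc's, hc'a, hc'a'⟩ := mem_restIdx_iff.mp hc'r
    obtain ⟨hprime, hnot⟩ := isPrime_idealB k m a a' c c' haa' (Ne.symm hca) (Ne.symm hc'a)
      (Ne.symm hca') (Ne.symm hc'a')
    refine ⟨c, c', Ne.symm hc'c, hcs, hc's, hca, hc'a, idealB k m a a' c c', hprime, ?_, hnot,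
      strictTransformT_mem_idealB k m s a a' hc, map_nodalCentrePreimage_le_idealB k m a a'⟩
    rw [idealB, Ideal.span_le]
    rintro x hx
    simp only [Set.mem_insert_iff, Set.mem_singleton_iff] at hx
    rcases hx with rfl | rfl | rfl | rfl
    exacts [hu, hv, hcQ, hc'Q]

end DeJong1996

end Literature.AlgebraicGeometry.Resolution

end
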